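import Literature.AlgebraicTopology.FundamentalGroupoid.SimplyConnectedComplPoint

/-!
# Paths can be pushed off finitely many points, up to homotopy rel end points (general position,
# local form)

Topic `Literature/Topology/FourManifolds` (infrastructure for the fact seat
`provefact-Literature.Geometry.Riemannian.LawsonMichelsohn1984_surrounding`: in Wall's form of the
trading of `1`-handles the return arc of Milnor's ideal circle (Lemma 8.3) must be chosen in a
prescribed homotopy class and off the finitely many left-hand `0`-spheres).  Everything here is
**proved**; no definitions.

* `exists_continuousMap_eqOn_forall_ne_local` — the general-position lemma
  `Literature.AlgebraicTopology.FundamentalGroupoid.exists_continuousMap_eqOn_forall_ne` (a map from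
  a compact uniform retract of `ℝᵐ` into a space with a Euclidean chart `i : E → M`, `m < dim E`,
  can be pushed off `i 0` rel a closed set `Z` whose image avoids it) with its **locality** made
  explicit: given `ρ₀ > 0`, the new map agrees with the old one except at points where both values
  lie in the small chart ball `i (B(0, 4ρ₀))` (its proof, verbatim, with the radius forced below
  `ρ₀` and the bound read off).  Combined with `exists_cover_homotopic_of_mapsTo`
  (`CloseMapsHomotopic.lean`) this makes the push a homotopy rel `Z`.

## References

* M. W. Hirsch, *Differential Topology* (1976), Ch. 3, Thm. 2.5 (general position). [HirschDT1976]
* J. Milnor, *Lectures on the h-cobordism theorem* (1965), proof of Lemma 8.3 (PDF pp. 55–56).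
  [MilnorHCobordism1965]
-/

open scoped Topology unitInterval
open Set Function Filter Metric Module Topology
open Literature.AlgebraicTopology.FundamentalGroupoid

noncomputable section

namespace Literature.Topology.FourManifolds

section Perturb

variable {E : Type*} [NormedAddCommGroup E] [NormedSpace ℝ E] [FiniteDimensional ℝ E]
  {W : Type*} [NormedAddCommGroup W] [NormedSpace ℝ W] [FiniteDimensional ℝ W]
  {K : Type*} [UniformSpace K] [CompactSpace K]
  {M : Type*} [TopologicalSpace M] [T2Space M]

/-- **General position off a point, local form.**  As
`Literature.AlgebraicTopology.FundamentalGroupoid.exists_continuousMap_eqOn_forall_ne`, with the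
extra conclusion that the new map `g` differs from `f` only at points `x` where both `f x` and `g x`
lie in the chart ball `i (B(0, 4ρ₀))`, for any prescribed `ρ₀ > 0`.
[cite: HirschDT1976, Ch. 3 Thm. 2.5] -/
theorem exists_continuousMap_eqOn_forall_ne_local {ι : K → W} {π : W → K} (hι : Continuous ι)
    (hπ : UniformContinuous π) (hπι : ∀ x, π (ι x) = x) (hWE : finrank ℝ W < finrank ℝ E)
    {i : E → M} (hi : IsOpenEmbedding i) (f : C(K, M)) {Z : Set K} (hZ : IsClosed Z)
    (hfZ : ∀ z ∈ Z, f z ≠ i 0) {ρ₀ : ℝ} (hρ₀ : 0 < ρ₀) :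
    ∃ g : C(K, M), EqOn g f Z ∧ (∀ x, g x ≠ i 0) ∧
      ∀ x, g x = f x ∨ (f x ∈ i '' ball 0 (4 * ρ₀) ∧ g x ∈ i '' ball 0 (4 * ρ₀)) := by
  classical
  -- Step 0: a closed ball around `0`, of radius `≤ ρ₀`, whose image misses `f '' Z`.
  obtain ⟨ρ, hρ, hρle, hρZ⟩ : ∃ ρ > (0 : ℝ), ρ ≤ ρ₀ ∧ ∀ v : E, ‖v‖ ≤ 4 * ρ → i v ∉ f '' Z := by
    have hc : IsClosed (f '' Z) := (hZ.isCompact.image f.continuous).isClosed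
    have h0 : i ⁻¹' (f '' Z)ᶜ ∈ 𝓝 (0 : E) := by
      refine (hc.isOpen_compl.preimage hi.continuous).mem_nhds ?_
      rintro ⟨z, hz, hz'⟩
      exact hfZ z hz hz'
    obtain ⟨ε, hε, hball⟩ := Metric.mem_nhds_iff.1 h0
    refine ⟨min (ε / 8) ρ₀, lt_min (by positivity) hρ₀, min_le_right _ _, fun v hv hv' => ?_⟩
    have hmin : min (ε / 8) ρ₀ ≤ ε / 8 := min_le_left _ _
    have : v ∈ ball (0 : E) ε := by rw [mem_ball_zero_iff]; linarith
    exact hball this hv'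
  -- Notation: the partial inverse of `i`, and the tubes `A r ⊆ O r'` around `f ⁻¹ p`.
  set e := hi.toOpenPartialHomeomorph i with he_def
  set h : K → E := fun x => e.symm (f x) with hh_def
  set S : Set K := f ⁻¹' range i with hS_def
  set A : ℝ → Set K := fun r => f ⁻¹' (i '' closedBall 0 r) with hA_def
  set O : ℝ → Set K := fun r => f ⁻¹' (i '' ball 0 r) with hO_def
  have hSo : IsOpen S := hi.isOpen_range.preimage f.continuous
  have hAc : ∀ r, IsClosed (A r) := fun r =>
    ((isCompact_closedBall (0 : E) r).image hi.continuous).isClosed.preimage f.continuous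
  have hOo : ∀ r, IsOpen (O r) := fun r => (hi.isOpenMap _ isOpen_ball).preimage f.continuous
  have hOA : ∀ r, O r ⊆ A r := fun r => preimage_mono (image_mono ball_subset_closedBall)
  have hAO : ∀ r r', r < r' → A r ⊆ O r' := fun r r' hrr' =>
    preimage_mono (image_mono (closedBall_subset_ball hrr'))
  have hOO : ∀ r r', r ≤ r' → O r ⊆ O r' := fun r r' hrr' =>
    preimage_mono (image_mono (ball_subset_ball hrr'))
  have hAS : ∀ r, A r ⊆ S := fun r => preimage_mono (image_subset_range _ _)
  have hih : ∀ x ∈ S, i (h x) = f x := fun x hx => hi.toOpenPartialHomeomorph_right_inv i hx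
  have hhi : ∀ v, e.symm (i v) = v := fun v => hi.toOpenPartialHomeomorph_left_inv i
  have hA_iff : ∀ r x, x ∈ A r ↔ x ∈ S ∧ ‖h x‖ ≤ r := by
    intro r x
    constructor
    · rintro ⟨v, hv, hvx⟩
      refine ⟨⟨v, hvx⟩, ?_⟩
      have : h x = v := by simp only [hh_def, ← hvx, hhi]
      rw [this]
      exact mem_closedBall_zero_iff.1 hv
    · rintro ⟨hxS, hxr⟩
      exact ⟨h x, mem_closedBall_zero_iff.2 hxr, hih x hxS⟩
  have hO_iff : ∀ r x, x ∈ O r ↔ x ∈ S ∧ ‖h x‖ < r := by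
    intro r x
    constructor
    · rintro ⟨v, hv, hvx⟩
      refine ⟨⟨v, hvx⟩, ?_⟩
      have : h x = v := by simp only [hh_def, ← hvx, hhi]
      rw [this]
      exact mem_ball_zero_iff.1 hv
    · rintro ⟨hxS, hxr⟩
      exact ⟨h x, mem_ball_zero_iff.2 hxr, hih x hxS⟩
  have hcont : ContinuousOn h S := by
    refine e.continuousOn_symm.comp f.continuous.continuousOn fun x hx => ?_
    rw [he_def, hi.toOpenPartialHomeomorph_target]
    exact hx
  -- Step 1: Urysohn cut-offs `φ` (`= 1` on `A ρ`, `= 0` off `O 2ρ`) and `χ` (`= 1` on `A 3ρ`,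
  -- `= 0` off `O 4ρ`).
  obtain ⟨φ, hφ0, hφ1, hφ01⟩ := exists_continuous_zero_one_of_isClosed (hOo (2 * ρ)).isClosed_compl
    (hAc ρ) (disjoint_compl_left_iff_subset.2 (hAO ρ (2 * ρ) (by linarith)))
  obtain ⟨χ, hχ0, hχ1, -⟩ := exists_continuous_zero_one_of_isClosed (hOo (4 * ρ)).isClosed_compl
    (hAc (3 * ρ)) (disjoint_compl_left_iff_subset.2 (hAO (3 * ρ) (4 * ρ) (by linarith)))
  -- Step 2: the local coordinate expression `h`, cut off to a global continuous `F : K → E`,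
  -- extended to `W` and smoothed.
  set F : K → E := fun x => χ x • h x with hF_def
  have hF : Continuous F := by
    rw [continuous_iff_continuousAt]
    intro x
    by_cases hx : x ∈ S
    · exact (χ.continuous.continuousAt).smul (hcont.continuousAt (hSo.mem_nhds hx))
    · have hx' : x ∉ A (4 * ρ) := fun h' => hx (hAS _ h')
      have hev : (fun _ => (0 : E)) =ᶠ[𝓝 x] F := by
        filter_upwards [(hAc (4 * ρ)).isOpen_compl.mem_nhds hx'] with y hy
        have hy' : y ∈ (O (4 * ρ))ᶜ := fun hy' => hy (hOA _ hy')
        have : χ y = 0 := hχ0 hy'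
        simp only [hF_def, this, zero_smul]
      exact continuousAt_const.congr hev
  have huc : UniformContinuous (F ∘ π) := (CompactSpace.uniformContinuous_of_continuous hF).comp hπ
  obtain ⟨g₁, hg₁, hg₁d⟩ := huc.exists_contDiff_dist_le (ε := ρ / 4) (by positivity)
  -- Step 3: a small vector `v` which is not a value of `g₁` (`dim W < dim E`).
  have hdense : Dense (range g₁)ᶜ :=
    (hg₁.of_le (by exact_mod_cast le_top)).dense_compl_range_of_finrank_lt_finrank hWE
  obtain ⟨v, hv, hvρ⟩ := hdense.exists_mem_open isOpen_ball
    ⟨(0 : E), mem_ball_self (by positivity : (0 : ℝ) < ρ / 4)⟩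
  rw [mem_ball_zero_iff] at hvρ
  -- Step 4: the perturbed map.
  set w : K → E := fun x => h x + φ x • (g₁ (ι x) - v - h x) with hw_def
  set gin : K → M := fun x => i (w x) with hgin_def
  have hgin_cont : ContinuousOn gin S := by
    refine hi.continuous.comp_continuousOn (hcont.add (φ.continuous.continuousOn.smul ?_))
    exact (((hg₁.continuous.comp hι).continuousOn.sub continuousOn_const).sub hcont)
  have hgin_eq : ∀ x ∈ S, x ∉ O (2 * ρ) → gin x = f x := by
    intro x hxS hxO
    have : φ x = 0 := hφ0 hxO
    simp only [hgin_def, hw_def, this, zero_smul, add_zero, hih x hxS]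
  set g : K → M := (O (3 * ρ)).piecewise gin f with hg_def
  have hclos : closure (O (3 * ρ)) ⊆ A (3 * ρ) := closure_minimal (hOA _) (hAc _)
  have hg : Continuous g := by
    refine continuous_piecewise (fun a ha => ?_) (hgin_cont.mono (hclos.trans (hAS _)))
      f.continuous.continuousOn
    -- on the frontier `φ = 0`, so `gin = i ∘ h = f`
    have ha1 : a ∈ A (3 * ρ) := hclos (frontier_subset_closure ha)
    have ha2 : a ∉ O (3 * ρ) := by
      have := ha.2
      rwa [(hOo _).interior_eq] at this
    exact hgin_eq a (hAS _ ha1) fun h' => ha2 (hOO _ _ (by linarith) h')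
  refine ⟨⟨g, hg⟩, fun z hz => ?_, fun x => ?_, fun x => ?_⟩
  · -- `g = f` on `Z`, since `Z` does not meet `O (3ρ)`
    have hz' : z ∉ O (3 * ρ) := by
      rintro ⟨u, hu, huz⟩
      exact hρZ u (by rw [mem_ball_zero_iff] at hu; linarith) ⟨z, hz, huz.symm⟩
    simp only [ContinuousMap.coe_mk, hg_def, piecewise_eq_of_notMem _ _ _ hz']
  · by_cases hx : x ∈ O (3 * ρ)
    · simp only [ContinuousMap.coe_mk, hg_def, piecewise_eq_of_mem _ _ _ hx, hgin_def]
      intro heq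
      have hw0 : w x = 0 := hi.injective heq
      obtain ⟨hxS, hx3⟩ := (hO_iff _ _).1 hx
      -- `g₁ (ι x)` is `ρ/4`-close to `h x`
      have hχx : χ x = 1 := hχ1 (hOA _ hx)
      have hFx : (F ∘ π) (ι x) = h x := by
        simp only [comp_apply, hπι, hF_def, hχx, one_smul]
      have hd : ‖g₁ (ι x) - h x‖ < ρ / 4 := by
        rw [← dist_eq_norm, ← hFx]
        exact hg₁d (ι x)
      have hd' : ‖g₁ (ι x) - v - h x‖ < ρ / 2 := by
        calc ‖g₁ (ι x) - v - h x‖ = ‖(g₁ (ι x) - h x) - v‖ := by congr 1; abel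
          _ ≤ ‖g₁ (ι x) - h x‖ + ‖v‖ := norm_sub_le _ _
          _ < ρ / 4 + ρ / 4 := add_lt_add hd hvρ
          _ = ρ / 2 := by ring
      by_cases hφx : φ x = 1
      · -- then `w x = g₁ (ι x) - v`, and `v` would be a value of `g₁`
        have : w x = g₁ (ι x) - v := by
          simp only [hw_def, hφx, one_smul]
          abel
        rw [this, sub_eq_zero] at hw0
        exact hv ⟨ι x, hw0⟩
      · -- then `‖h x‖ > ρ` while the perturbation has norm `< ρ/2`
        have hxA : x ∉ A ρ := fun h' => hφx (hφ1 h')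
        rw [hA_iff] at hxA
        have hρx : ρ < ‖h x‖ := by
          by_contra hle
          exact hxA ⟨hxS, not_lt.1 hle⟩
        have hφx' : ‖φ x‖ ≤ 1 := by
          have := hφ01 x
          rw [Real.norm_eq_abs, abs_le]
          exact ⟨by linarith [this.1], this.2⟩
        have : h x = -(φ x • (g₁ (ι x) - v - h x)) := eq_neg_of_add_eq_zero_left hw0
        have : ‖h x‖ < ρ / 2 := by
          rw [this, norm_neg]
          calc ‖φ x • (g₁ (ι x) - v - h x)‖ = ‖φ x‖ * ‖g₁ (ι x) - v - h x‖ := norm_smul _ _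
            _ ≤ 1 * ‖g₁ (ι x) - v - h x‖ := by gcongr
            _ < ρ / 2 := by rw [one_mul]; exact hd'
        linarith
    · simp only [ContinuousMap.coe_mk, hg_def, piecewise_eq_of_notMem _ _ _ hx]
      intro heq
      exact hx ⟨0, mem_ball_self (by positivity), heq.symm⟩
  · -- locality: `g = f` off `O (3ρ)`; inside, both values lie in `i (ball 0 (4ρ))`
    by_cases hx : x ∈ O (3 * ρ)
    · right
      obtain ⟨hxS, hx3⟩ := (hO_iff _ _).1 hx
      have hsub : i '' ball (0 : E) (4 * ρ) ⊆ i '' ball 0 (4 * ρ₀) :=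
        image_mono (ball_subset_ball (by linarith))
      constructor
      · refine hsub ⟨h x, ?_, hih x hxS⟩
        rw [mem_ball_zero_iff]; linarith
      · simp only [ContinuousMap.coe_mk, hg_def, piecewise_eq_of_mem _ _ _ hx, hgin_def]
        refine hsub ⟨w x, ?_, rfl⟩
        rw [mem_ball_zero_iff]
        have hχx : χ x = 1 := hχ1 (hOA _ hx)
        have hFx : (F ∘ π) (ι x) = h x := by
          simp only [comp_apply, hπι, hF_def, hχx, one_smul]
        have hd : ‖g₁ (ι x) - h x‖ < ρ / 4 := by
          rw [← dist_eq_norm, ← hFx]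
          exact hg₁d (ι x)
        have hd' : ‖g₁ (ι x) - v - h x‖ < ρ / 2 := by
          calc ‖g₁ (ι x) - v - h x‖ = ‖(g₁ (ι x) - h x) - v‖ := by congr 1; abel
            _ ≤ ‖g₁ (ι x) - h x‖ + ‖v‖ := norm_sub_le _ _
            _ < ρ / 4 + ρ / 4 := add_lt_add hd hvρ
            _ = ρ / 2 := by ring
        have hφx' : ‖φ x‖ ≤ 1 := by
          have := hφ01 x
          rw [Real.norm_eq_abs, abs_le]
          exact ⟨by linarith [this.1], this.2⟩
        calc ‖w x‖ = ‖h x + φ x • (g₁ (ι x) - v - h x)‖ := by rw [hw_def]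
          _ ≤ ‖h x‖ + ‖φ x • (g₁ (ι x) - v - h x)‖ := norm_add_le _ _
          _ ≤ ‖h x‖ + 1 * ‖g₁ (ι x) - v - h x‖ := by
              rw [norm_smul]; gcongr
          _ < 3 * ρ + ρ / 2 := by rw [one_mul]; exact add_lt_add hx3 hd'
          _ ≤ 4 * ρ := by linarith
    · left
      simp only [ContinuousMap.coe_mk, hg_def, piecewise_eq_of_notMem _ _ _ hx]

end Perturb

end Literature.Topology.FourManifolds

end
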